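/-
Copyright (c) 2026. All rights reserved.
Released under Apache 2.0 license as described in the file LICENSE.
-/
import Literature.NumberTheory.Waring.ThreeSquaresCount
import Mathlib.NumberTheory.LegendreSymbol.JacobiSymbol
import HarnessLib

/-!
# Hurwitz's count of the representations of a square as a sum of three squares: `r₃(p²) = 6(p + 1 − (−4∕p))`, `r₃(n²)`

For an odd prime `p`, `r₃(p²) = #{y ∈ ℤ³ : y₁² + y₂² + y₃² = p²} = 6·(p + 1 − (−4∕p))`, i.e. `6p` for
`p ≡ 1 (mod 4)` and `6(p + 2)` for `p ≡ 3 (mod 4)` — the prime case of HURWITZ'S THEOREM on `r₃(n²)` (Grosswald,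
Ch. 10 §1 Thm. 3: for `n = 2ᵃ m ∏ q_j^{a_j}`, `q_j ≡ 3 (mod 4)`, `p ≡ 1 (mod 4)` for `p ∣ m`, `r₃(n²)` is `6m` times a
product over the `q_j`); and `r₃(4ᵃ) = 6`. From Gauss's count of the tree (`ThreeSquaresCount.card_eq_of_mod_four`:
`r₃(p²) = 12H(4p²)`), the Hecke relation `H(4p²) = (p + 1 − (−4∕p))·H(4)` at conductor `1`
(`hurwitzClassNumber_hecke`) and `H(4) = ½`.

* §1 `conductor_zero_one` (`F(0, 1) = 1`: `−4` is fundamental), **`hurwitzClassNumber_four_mul_prime_sq`**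
  (`H(4p²) = (p + 1 − (−4∕p))/2`), `jacobiSym_neg_four` (`(−4∕p) = ±1` by `p mod 4`).
* §2 **`card_prime_sq`** (`r₃(p²) = 6(p + 1 − (−4∕p))`), **`card_prime_sq_of_mod_four_eq_one`** (`= 6p`),
  **`card_prime_sq_of_mod_four_eq_three`** (`= 6(p + 2)`), `card_four_pow` (`r₃(4ᵃ) = 6`), values `r₃(9) = 30`,
  `r₃(25) = 30`, `r₃(49) = 54`.
* §3 `hurwitzClassNumber_four_mul_sq_of_odd` (`H(4n²) = ½ Σ_{c ∣ n} c ∏_{p ∣ c}(1 − (−4∕p)/p)`, `n` odd),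
  **`card_sq_of_odd`** (HURWITZ'S THEOREM for odd `n` in divisor-sum form: `r₃(n²) = 6 Σ_{c ∣ n} c ∏_{p ∣ c}(1 − (−4∕p)/p)`),
  `card_sq_two_pow_mul` (`r₃((2ᵃk)²) = r₃(k²)`: all squares).

## Sources

* E. Grosswald, *Representations of Integers as Sums of Squares* (1985), Ch. 10 §1 Thm. 3 (Hurwitz [119]: A. Hurwitz,
  L'Intermédiaire des Math. 14 (1907), 107; the formula for `r₃(n²)`). [cite: Grosswald1985, Ch. 10 §1 Thm. 3]
* H. Cohen, *A Course in Computational Algebraic Number Theory* (1993), §5.3.2 Lemma 5.3.7, p. 234 (the conductor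
  relations of `H`). [cite: Cohen1993, §5.3.2 Lemma 5.3.7, p. 234]

## Scope (honest)

Theorems only — no definition, no named fact, no instance. Hurwitz's theorem is given for `n = p` explicitly and for
all `n` in the divisor-sum form (the printed Euler-product spelling is left as a TODO); `(−4∕p)` is Mathlib's
`jacobiSym (-4) p`.
-/

open Literature.NumberTheory.QuadraticFields
open Literature.NumberTheory.Automorphic.Brandt

namespace Literature.NumberTheory.Waring.ThreeSquaresCountPrimeSquare

/-! ## §1 `H(4p²) = (p + 1 − (−4∕p))/2` -/

section ClassNumber

/-- The conductor of `(t, n) = (0, 1)` is `1`: `t² − 4n = −4` is a fundamental discriminant.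
[cite: Cohen1993, §5.3.2 Def. 5.3.6 and Lemma 5.3.7, p. 234] -/
theorem conductor_zero_one : conductor 0 1 = 1 := by
  refine (conductor_eq_one_iff_isFundamental (t := 0) (n := 1) (by norm_num)).2 (Or.inr ⟨by norm_num, ?_, ?_⟩)
  · norm_num
  · rw [show ((0 : ℤ) ^ 2 - 4 * ((1 : ℕ) : ℤ)) / 4 = -1 by norm_num]
    exact isUnit_one.neg.squarefree

/-- **`H(4p²) = (p + 1 − (−4∕p))·H(4) = (p + 1 − (−4∕p))/2` for an odd prime `p`**: the Hecke relation of the tree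
(`hurwitzClassNumber_hecke`) at `N = 4`, conductor `1`, with `H(4) = ½`. [cite: Cohen1993, §5.3.2 Lemma 5.3.7, p. 234] -/
theorem hurwitzClassNumber_four_mul_prime_sq {p : ℕ} (hp : p.Prime) (hp2 : p ≠ 2) :
    hurwitzClassNumber (4 * ((p ^ 2 : ℕ) : ℤ)) = ((p : ℚ) + 1 - jacobiSym (-4) p) / 2 := by
  have hk := hurwitzClassNumber_hecke (t := 0) (n := 1) (by norm_num) hp
  have hnd : ¬ p ∣ 1 := fun h => hp.one_lt.ne' (Nat.dvd_one.1 h)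
  have e1 : (4 : ℤ) * ((1 : ℕ) : ℤ) - 0 ^ 2 = 4 := by norm_num
  have e2 : (0 : ℤ) ^ 2 - 4 * ((1 : ℕ) : ℤ) = -4 := by norm_num
  rw [conductor_zero_one, if_neg hnd, if_neg hp2, mul_zero, add_zero, e1, e2, hurwitzClassNumber_four] at hk
  rw [show (4 : ℤ) * ((p ^ 2 : ℕ) : ℤ) = ((p : ℤ)) ^ 2 * 4 by push_cast; ring, hk]
  ring

/-- `(−4∕p) = (−1∕p) = +1, −1` for `p ≡ 1, 3 (mod 4)` (`p` an odd prime). [folklore] -/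
private theorem jacobiSym_neg_four {p : ℕ} (hp : p.Prime) (hp2 : p ≠ 2) :
    jacobiSym (-4) p = if p % 4 = 1 then 1 else -1 := by
  have hodd : Odd p := hp.odd_of_ne_two hp2
  have hgcd : Int.gcd 2 p = 1 := by
    rw [show Int.gcd 2 p = Nat.gcd 2 p from rfl]
    exact (Nat.coprime_primes Nat.prime_two hp).2 (Ne.symm hp2)
  rw [show (-4 : ℤ) = -1 * 2 ^ 2 by norm_num, jacobiSym.mul_left, jacobiSym.at_neg_one hodd,
    jacobiSym.sq_one' hgcd, mul_one]
  split_ifs with h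
  · exact ZMod.χ₄_nat_one_mod_four h
  · exact ZMod.χ₄_nat_three_mod_four (by obtain ⟨k, hk⟩ := hodd; omega)

end ClassNumber

/-! ## §2 `r₃(p²) = 6(p + 1 − (−4∕p))` -/

section Count

/-- **HURWITZ (the prime case): `r₃(p²) = 6·(p + 1 − (−4∕p))` for an odd prime `p`** — `r₃(p²) = 12H(4p²)`
(`p² ≡ 1 (mod 4)`, the tree's `ThreeSquaresCount.card_eq_of_mod_four`) and §1.
[cite: Grosswald1985, Ch. 10 §1 Thm. 3 (Hurwitz), case n = p] -/
theorem card_prime_sq {p : ℕ} (hp : p.Prime) (hp2 : p ≠ 2) :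
    (Nat.card {y : ℤ × ℤ × ℤ // y.1 ^ 2 + y.2.1 ^ 2 + y.2.2 ^ 2 = ((p ^ 2 : ℕ) : ℤ)} : ℚ) = 6 * ((p : ℚ) + 1 - jacobiSym (-4) p) := by
  have h4 : p ^ 2 % 4 = 1 := by
    have hodd : Odd p := hp.odd_of_ne_two hp2
    obtain ⟨k, hk⟩ := hodd
    rw [Nat.pow_mod]
    rcases (show p % 4 = 1 ∨ p % 4 = 3 by omega) with h | h <;> rw [h]
  rw [ThreeSquaresCount.card_eq_of_mod_four (Or.inl h4), hurwitzClassNumber_four_mul_prime_sq hp hp2]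
  ring

/-- **`r₃(p²) = 6p` for a prime `p ≡ 1 (mod 4)`** (Hurwitz's `6m`, `m = p`). [cite: Grosswald1985, Ch. 10 §1 Thm. 3] -/
theorem card_prime_sq_of_mod_four_eq_one {p : ℕ} (hp : p.Prime) (h1 : p % 4 = 1) :
    Nat.card {y : ℤ × ℤ × ℤ // y.1 ^ 2 + y.2.1 ^ 2 + y.2.2 ^ 2 = ((p ^ 2 : ℕ) : ℤ)} = 6 * p := by
  have h := card_prime_sq hp (by omega)
  rw [jacobiSym_neg_four hp (by omega), if_pos h1] at h
  have h' : (Nat.card {y : ℤ × ℤ × ℤ // y.1 ^ 2 + y.2.1 ^ 2 + y.2.2 ^ 2 = ((p ^ 2 : ℕ) : ℤ)} : ℚ) = ((6 * p : ℕ) : ℚ) := by rw [h]; push_cast; ring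
  exact_mod_cast h'

/-- **`r₃(q²) = 6(q + 2)` for a prime `q ≡ 3 (mod 4)`** (Hurwitz's factor `q + (q − 1)/(q − 1)·2 …`, i.e.
`q^{a} + 2(q^{a} − 1)/(q − 1)` at `a = 1`). [cite: Grosswald1985, Ch. 10 §1 Thm. 3] -/
theorem card_prime_sq_of_mod_four_eq_three {p : ℕ} (hp : p.Prime) (h3 : p % 4 = 3) :
    Nat.card {y : ℤ × ℤ × ℤ // y.1 ^ 2 + y.2.1 ^ 2 + y.2.2 ^ 2 = ((p ^ 2 : ℕ) : ℤ)} = 6 * (p + 2) := by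
  have h := card_prime_sq hp (by omega)
  rw [jacobiSym_neg_four hp (by omega), if_neg (by omega)] at h
  have h' : (Nat.card {y : ℤ × ℤ × ℤ // y.1 ^ 2 + y.2.1 ^ 2 + y.2.2 ^ 2 = ((p ^ 2 : ℕ) : ℤ)} : ℚ) = ((6 * (p + 2) : ℕ) : ℚ) := by rw [h]; push_cast; ring
  exact_mod_cast h'

/-- `r₃(4ᵃ) = 6` (`r₃(4n) = r₃(n)` and `r₃(1) = 6`). [cite: Grosswald1985, Ch. 4 §8 (4.8) and Ch. 10 §1 Thm. 3 (n = 2ᵃ)] -/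
theorem card_four_pow (a : ℕ) : Nat.card {y : ℤ × ℤ × ℤ // y.1 ^ 2 + y.2.1 ^ 2 + y.2.2 ^ 2 = ((4 ^ a : ℕ) : ℤ)} = 6 := by
  induction a with
  | zero => simpa only [pow_zero, Nat.cast_one] using ThreeSquaresCount.card_one
  | succ a ih => rw [pow_succ', ThreeSquaresCount.card_four_mul, ih]

/-- `r₃(9) = 30` (`= 6·(3 + 2)`: `(±3, 0, 0)` and `(±2, ±2, ±1)` up to order). [cite: Grosswald1985, Ch. 10 §1 Thm. 3] -/
theorem card_nine : Nat.card {y : ℤ × ℤ × ℤ // y.1 ^ 2 + y.2.1 ^ 2 + y.2.2 ^ 2 = 9} = 30 := by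
  have h := card_prime_sq_of_mod_four_eq_three Nat.prime_three rfl
  simp only [show ((3 ^ 2 : ℕ) : ℤ) = 9 by norm_num] at h
  exact h

/-- `r₃(25) = 30` (`= 6·5`: `(±5, 0, 0)` and `(±3, ±4, 0)` up to order). [cite: Grosswald1985, Ch. 10 §1 Thm. 3] -/
theorem card_twentyfive : Nat.card {y : ℤ × ℤ × ℤ // y.1 ^ 2 + y.2.1 ^ 2 + y.2.2 ^ 2 = 25} = 30 := by
  have h := card_prime_sq_of_mod_four_eq_one Nat.prime_five rfl
  simp only [show ((5 ^ 2 : ℕ) : ℤ) = 25 by norm_num] at h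
  exact h

/-- `r₃(49) = 54` (`= 6·(7 + 2)`). [cite: Grosswald1985, Ch. 10 §1 Thm. 3] -/
theorem card_fortynine : Nat.card {y : ℤ × ℤ × ℤ // y.1 ^ 2 + y.2.1 ^ 2 + y.2.2 ^ 2 = 49} = 54 := by
  have h := card_prime_sq_of_mod_four_eq_three (by norm_num : Nat.Prime 7) rfl
  simp only [show ((7 ^ 2 : ℕ) : ℤ) = 49 by norm_num] at h
  exact h

end Count

/-! ## §3 Hurwitz's theorem for odd `n`: `r₃(n²) = 6 Σ_{c ∣ n} c ∏_{p ∣ c} (1 − (−4∕p)/p)` -/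

section OddSquares

/-- The discriminant datum of `(0, 1)`: `t_F² − 4n_F = −4`. [cite: Cohen1993, §5.3.2 Lemma 5.3.7, p. 234] -/
private theorem disc_zero_one : tOf 0 1 (conductor 0 1) ^ 2 - 4 * nOf 0 1 (conductor 0 1) = -4 := by
  rw [conductor_zero_one, ← disc_div_sq (by norm_num) (one_mem_ellipticConductors (by norm_num))]
  norm_num

/-- **`H(4n²) = ½ Σ_{c ∣ n} c ∏_{p ∣ c} (1 − (−4∕p)/p)` for odd `n ≥ 1`** (the closed form of the tree,
`hurwitzClassNumber_sq_mul`, at `N = 4`: conductor `1`, `h_w(−4) = ½`; every `p ∣ c ∣ n` is odd).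
[cite: Cohen1993, §5.3.2 Lemma 5.3.7, p. 234] -/
theorem hurwitzClassNumber_four_mul_sq_of_odd {n : ℕ} (hn : Odd n) :
    hurwitzClassNumber (4 * ((n ^ 2 : ℕ) : ℤ)) =
      1 / 2 * ∑ c ∈ n.divisors, ((c : ℚ) * ∏ p ∈ c.primeFactors, (1 - (jacobiSym (-4) p : ℚ) / p)) := by
  have hk := hurwitzClassNumber_sq_mul (t := 0) (n := 1) (by norm_num) hn.pos
  rw [disc_zero_one, conductor_zero_one, mul_one] at hk
  have hw : Automorphic.HeckeTraceFormulaGL2Level.weightedClassNumber (-4) = 1 / 2 := by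
    unfold Automorphic.HeckeTraceFormulaGL2Level.weightedClassNumber
    rw [if_neg (by norm_num), if_pos rfl]
  rw [show (4 : ℤ) * ((n ^ 2 : ℕ) : ℤ) = ((n : ℤ)) ^ 2 * (4 * ((1 : ℕ) : ℤ) - 0 ^ 2) by push_cast; ring, hk, hw]
  congr 1
  refine Finset.sum_congr rfl fun c hc => ?_
  congr 1
  refine Finset.prod_congr rfl fun p hp => ?_
  have hp2 : p ≠ 2 := by
    rintro rfl
    have h2c : 2 ∣ c := Nat.dvd_of_mem_primeFactors hp
    have hcn : c ∣ n := Nat.dvd_of_mem_divisors hc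
    exact (Nat.not_even_iff_odd.2 hn) (even_iff_two_dvd.2 (h2c.trans hcn))
  rw [if_neg hp2]

/-- **HURWITZ'S THEOREM FOR ODD `n`: `r₃(n²) = 6·Σ_{c ∣ n} c·∏_{p ∣ c} (1 − (−4∕p)/p)`** — the divisor-sum form of
Grosswald's Ch. 10 Thm. 3 («r₃(n²) = 6m ∏ …», whose product over the primes of `n` is the multiplicative evaluation of
this sum: the summand is multiplicative in `c`, with local factor `p^b` at `p ≡ 1 (mod 4)` and `p^b + 2(p^b − 1)/(p − 1)`
at `p ≡ 3 (mod 4)`); from `r₃(n²) = 12H(4n²)` and the closed form of `H(4n²)`.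
-- TODO(general form): the Euler-product spelling `6m ∏_q (q^a + 2(q^a − 1)/(q − 1))` as printed.
[cite: Grosswald1985, Ch. 10 §1 Thm. 3 (Hurwitz [119])] -/
theorem card_sq_of_odd {n : ℕ} (hn : Odd n) :
    (Nat.card {y : ℤ × ℤ × ℤ // y.1 ^ 2 + y.2.1 ^ 2 + y.2.2 ^ 2 = ((n ^ 2 : ℕ) : ℤ)} : ℚ) =
      6 * ∑ c ∈ n.divisors, ((c : ℚ) * ∏ p ∈ c.primeFactors, (1 - (jacobiSym (-4) p : ℚ) / p)) := by
  have h4 : n ^ 2 % 4 = 1 := by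
    obtain ⟨k, hk⟩ := hn
    rw [Nat.pow_mod]
    rcases (show n % 4 = 1 ∨ n % 4 = 3 by omega) with h | h <;> rw [h]
  rw [ThreeSquaresCount.card_eq_of_mod_four (Or.inl h4), hurwitzClassNumber_four_mul_sq_of_odd hn]
  ring

/-- … and for every `n = 2ᵃk`, `k` odd: `r₃(n²) = r₃(k²)` (`r₃(4m) = r₃(m)`), so Hurwitz's formula covers all squares.
[cite: Grosswald1985, Ch. 10 §1 Thm. 3 and Ch. 4 §8 (4.8)] -/
theorem card_sq_two_pow_mul {k : ℕ} (a : ℕ) (hk : Odd k) :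
    (Nat.card {y : ℤ × ℤ × ℤ // y.1 ^ 2 + y.2.1 ^ 2 + y.2.2 ^ 2 = (((2 ^ a * k) ^ 2 : ℕ) : ℤ)} : ℚ) =
      6 * ∑ c ∈ k.divisors, ((c : ℚ) * ∏ p ∈ c.primeFactors, (1 - (jacobiSym (-4) p : ℚ) / p)) := by
  rw [← card_sq_of_odd hk]
  congr 1
  induction a with
  | zero => simp
  | succ a ih =>
    rw [show (2 ^ (a + 1) * k) ^ 2 = 4 * ((2 ^ a * k) ^ 2) by ring, ThreeSquaresCount.card_four_mul]
    exact ih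

end OddSquares

end Literature.NumberTheory.Waring.ThreeSquaresCountPrimeSquare
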